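import Mathlib.Analysis.Complex.Exponential
import Mathlib.Algebra.Order.BigOperators.Group.Finset
import HarnessLib

/-!
# K2R `RealisedQuasiStaticCellLaw`, line `floquet-bloch`, stub `stub_lowSectorWeakNear`: scalar glue between the isotropy
# bound `μ` and the END / smallness hypotheses of `comoving_transport_lower` (helper; `--supports stmt-AnomalousDissipation-20446`)

Summits-side helper file (pure real arithmetic; no definitions, no named facts).
* `sum_exp_sub_one_le_two_mul`: for nonnegative exponents with `Σ_j X_j ≤ 1`, `Σ_j (e^{X_j} − 1) ≤ 2Σ_j X_j`
  (feeds `hsmallX` of `comoving_transport_lower`, p586227);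
* `exp_two_mul_le_transport_sq`: if `0 ≤ x ≤ 1` and `x + x² + S² ≤ μ` then `e^{2x} ≤ (1 + μ − S²)²` — with `x = λ̄P` this
  is the hypothesis `hEND` of `comoving_end` (p584793) from the conclusion of `comoving_transport_lower`.
-/

set_option linter.dupNamespace false

namespace Summit.AnomalousDissipation.AnomalousDissipation.Theorems.SolenoidalFractalHomogenisation.RealisedQuasiStaticCellLaw

open Finset

/-- `Σ_j (e^{X_j} − 1) ≤ 2 Σ_j X_j` when `X_j ≥ 0` and `Σ_j X_j ≤ 1`. -/
theorem sum_exp_sub_one_le_two_mul {ι : Type*} (s : Finset ι) (X : ι → ℝ) (h0 : ∀ i ∈ s, 0 ≤ X i)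
    (h1 : ∑ i ∈ s, X i ≤ 1) : ∑ i ∈ s, (Real.exp (X i) - 1) ≤ 2 * ∑ i ∈ s, X i := by
  rw [mul_sum]
  refine sum_le_sum fun i hi => ?_
  have hXi : X i ≤ 1 := le_trans (single_le_sum h0 hi) h1
  have habs : |X i| ≤ 1 := by rw [abs_of_nonneg (h0 i hi)]; exact hXi
  have h := Real.abs_exp_sub_one_le habs
  rw [abs_of_nonneg (h0 i hi)] at h
  exact le_trans (le_abs_self _) h

/-- `e^{2x} ≤ (1 + μ − S²)²` when `0 ≤ x ≤ 1` and `x + x² + S² ≤ μ` (`e^x ≤ 1 + x + x²` on `[0,1]`). -/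
theorem exp_two_mul_le_transport_sq {x μ S2 : ℝ} (hx0 : 0 ≤ x) (hx1 : x ≤ 1) (hμ : x + x ^ 2 + S2 ≤ μ) :
    Real.exp (2 * x) ≤ (1 + μ - S2) ^ 2 := by
  have habs : |x| ≤ 1 := by rw [abs_of_nonneg hx0]; exact hx1
  have h := Real.abs_exp_sub_one_sub_id_le habs
  have h1 : Real.exp x ≤ 1 + x + x ^ 2 := by
    have := le_trans (le_abs_self _) h
    linarith
  have h2 : Real.exp x ≤ 1 + μ - S2 := by linarith
  rw [show 2 * x = x + x by ring, Real.exp_add, ← sq]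
  exact pow_le_pow_left₀ (Real.exp_pos x).le h2 2

end Summit.AnomalousDissipation.AnomalousDissipation.Theorems.SolenoidalFractalHomogenisation.RealisedQuasiStaticCellLaw
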